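import Literature.MathematicalPhysics.QuantumFieldTheory.Balaban1983to89.Node00.Sect2FrameOfRecord
import Literature.MathematicalPhysics.QuantumFieldTheory.Balaban1983to89.TreeLengthTorusGeometry
import Literature.MathematicalPhysics.QuantumFieldTheory.Balaban1983to89.B13Resummation
import Literature.MathematicalPhysics.QuantumFieldTheory.Balaban1983to89.T4ActivityLipschitz
import Literature.MathematicalPhysics.QuantumFieldTheory.Balaban1983to89.T4HistoryLipschitzRecursion
import Literature.MathematicalPhysics.QuantumFieldTheory.Balaban1983to89.B12CouplingClausesHistory

/-!
# NODE 00 — DEFINER W1, FILE `HistoryTermsOfRecord`: the ONE-STEP CLUSTER TERMS `E^{(k+1)}(X; g₀,…,g_k; (𝐔,𝐉))` of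
# [II] §2 (2.13)–(2.14) OF RECORD, WITH THE COUPLING HISTORY, and the history functional they define on the torus catalogue

Cell `pub-ymgap`, NODE 00, definer seat `pub-ymgap-node00-def-W1` (director R134 (c); FAN-OUT v1.1 §N22 s1 «THE HISTORY-LIPSCHITZ
OBJECT W1 = [II] §2 (2.13)–(2.14) as a Lean object on the record's torus catalogue + (1.17) ‖E′‖ on U^c_k (object-bound)»).
[I] = [Balaban1987RG1] (held `paper:balaban1987-cmp109-rg-i-small-field`, journal page = PDF page + 248), [II] = [Balaban1988RG2Cluster]
(held `paper:balaban1988-cmp116-rg-ii-cluster`, journal page = PDF page), [III] = [Balaban1988Convergent].  Source displays re-read this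
session on the text layers ([II] pp. 14–15, 20–22; [I] p. 263), verbatim:

  [II] (2.9) p.14 «(2.1) = Σ_Z H(Z), where H(Z) = Σ_{Z₀: Z₀^∼ = Z} H(Z, Z₀) … This is the desired expansion into localized quantities. The
        function H(Z) is localized in the interior of Z with respect to the external gauge fields»; (2.10)–(2.11) p.14 the polymer
        expansion «where the function ζ(Z, Z′) is defined by the condition: ζ(Z, Z′) = 0 if Z ∩ Z′ contains a cube, or a wall of a cube,
        and ζ(Z, Z′) = 1 otherwise»;
  [II] (2.13) p.14 «The representation (I.1.7) for E^{(k+1)} is constructed by taking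
        E^{(k+1)}(X) = Σ_{n=1}^{∞} (1∕n!) Σ_{(Z₁,…,Z_n): ∪Z_i = X} ρ^T(Z₁,…,Z_n) H(Z₁)⋯H(Z_n), (2.13) where X ∈ 𝐃_{k+1}»;
  [II] p.14–15 «The activities H(Z) are sums of many terms, more exactly the sums in (2.9), (2.1), (2.3) over Z₀, 𝐃, P. … Of course
        Y ⊂ Z₀, and Z̃₀ ⊂ Z ⊂ X for the activities in (2.13). … Thus the activities in (2.13), and the whole sum E^{(k+1)}(X), are analytic
        functions of (𝐔, 𝐉), on the space U^c_{k+1}(X, α₀, α₁). This is the analyticity statement in the inductive assumptions.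
        To get a bound for H(Z) we consider a term in the sum over 𝐃, P. This term can be written in the following form: … (2.14)»;
  [II] Lemma 3 (2.38) p.20 «the activity H(Z) for a localization domain Z ∈ 𝐃_{k+1} satisfies the inequality
        |H(Z)| ≤ C₃ε₁ exp(−(1 − 8δ)½Lκ d_{k+1}(Z))»; (2.41) p.21 «|E^{(k+1)}(X)| ≤ O(1)C₃ε₁ exp(−(1 − 10δ)½Lκ d_{k+1}(X))»;
  [II] p.21–22 «the expressions (2.14) are gauge invariant with respect to all G-valued transformations. The expressions are analytic
        functions of (𝐔,𝐉), hence the invariance can be extended, by the analyticity, to Gᶜ-valued gauge transformations»;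
  [I]  p.263 «We assume that the function E^{(j)}(X, g_{j−1}, 𝐔, 𝐉) is defined and analytic on the space U^c_j(X, α₀, α₁) … It depends
        on the configurations restricted to X, i.e. on (𝐔, 𝐉)|_X. It is a C^∞-function of g_{j−1} ∈ [0, γ], (or analytic) … There exists
        a constant E₀ such that |E^{(j)}(X, g_{j−1}, 𝐔, 𝐉)| ≤ E₀ exp(−κ d_j(X)) (1.18)»; (1.19) gauge invariance; p.263 before (1.18): the
        configurations satisfying (i)–(iii) with smaller constants α′₀, α′₁ lie in U^c_j(X, α₀, α₁) — the margin on which a Cauchy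
        estimate turns (1.18) into a bound of the configuration derivative E′ (FAN-OUT «(1.17) ‖E′‖ on U^c_k, object-bound»);
  [I]  p.256 «The function E_k depends also on the effective coupling constants g₀, …, g_{k−1}»; (0.23) p.256: no term before step 1.

WHAT THIS FILE TYPES (hypothesis-schema, total definitions, nothing asserted; D-0064 one module).  The record's frame is FILE 11b
`Node00.Sect2FrameOfRecord`: `𝐃_j` of record `Sect2.domSys P M j` = the torus catalogue `TreeLengthTorus.tsys P.d (domCount P M j)` with
`d_j = torusTreeLen`, domains read as site sets `Sect2.domSites`, complex configurations `Φ = Sect2.CPair P 𝔸` with the gauge action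
`Sect2.cAct`, the real reading `Sect2.ofBackgroundC`, locality `Sect2.agreeOnSet`, the spaces `U^c_j(X, α₀, α₁)` of record `Sect2.spaceI`.
ON THAT FRAME, and on the torus polymer geometry the estimate side already serves (polymers `(tsys _ _).Dom`, incompatibility `TTouch`,
footprint `(·.1)`, `d = torusTreeLen`: `TreeLengthTorusGeometry.tgeometry`, every geometric field PROVED there):
* §1 the CARRIERS OF RECORD in the shape `T4OutputRate.Carriers` (index type `Σ j, 𝐃_j`, creation step, `d_j`), the two-run pairing data
  (UNPRINTED; an INPUT `RunPairing`, supplied by the N18∕NE5 side);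
* §2 the ONE-STEP CLUSTER DATA at step `k` (`ClusterStep`): the multi-indices `(𝐃 ⊂ 𝐃_k, P, Z₀, …)` of (2.9)–(2.11) as an abstract index
  type with the finite set of those producing `Z` ((2.10)), and the generic term (2.14) as a function of the YOUNG COUPLINGS `(g₀, …, g_k)`
  — typed as a prefix `Fin (k+1) → ℝ`, so that prefix dependence ([I] p.256) is definitional — and of `(𝐔, 𝐉) ∈ Φ`; the activity
  `H(Z)` (2.9)∕(2.11) := the finite sum of the terms; **`E^{(k+1)}(X)` := (2.13) AS A DEFINITION**, in the tree's Kotecký–Preiss form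
  `B13Resummation.locE` on `tgeometry` (the `W.Ek1 = locE …` representation line of `B13Resummation.Repr213` ∕ `B13Lemma3Torus` made
  history-indexed and definitional; the printed `Σ_n (1∕n!) Σ ρ^T` form is `B13MayerDecoupling.ursellSeries213`, a `tsum`);
* §3 the tower of steps and THE HISTORY FUNCTIONAL OF RECORD `functional S ι p : T4OutputRate.Functional (histCarriers P M p) (GaugeField P 0 G)`,
  `(g, U, ⟨j, X⟩) ↦ Re E^{(j)}(X; g₀, …, g_{j−1}; (ι U, 0))` (`0` at `j = 0`) — the `EA` of the U3 bundle on which `T4OutputRate.NE9` ∕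
  `T4HistoryLipschitzRecursion.StepLipschitz` ∕ `T4CouplingAnalyticity.CouplingAnalytic` are stated BY NAME; the spaces and coupling boxes
  of record as tables;
* §2b∕§4 NAMED PREDICATES, asserted nowhere: analyticity of `H` and of the terms on a space table ((2.13an) p.15), Lemma 3's (2.38), the
  termwise (2.26)-majorant shape, localization (p.15), gauge invariance (pp.21–22), the restriction property of the spaces (p.15 =
  `B13Resummation.SpRestr` at the record), the NOT-PRINTED differenced (2.38) in the young couplings (`YoungLipschitz`, the slot the N22
  estimate rows fill), and on the tower the (1.18)-shape bound, analyticity ([I] p.263) and **the configuration-derivative bound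
  `‖E′‖ ≤ E₁e^{−r d_j(X)}` on a space table (`DerivBoundOn`, `TermDerivBound`) — the (1.17)∕(1.18) object-bound**;
* §4b the PRINTED coupling-regularity clauses of [I] p.263 ∕ p.266 (`B12CouplingClausesHistory.SmoothInLast263` ∕
  `AnalyticInEachCoupling266`, typer seat NE-I) READ ON THE OBJECT by name;
* §2c∕§5 PROVED GLUE (bookkeeping): `E = T4ActivityLipschitz.clusterSum TTouch …` (`rfl`, Road 1's engine object), localization and gauge
  invariance of `E^{(k+1)}` from those of `H` (`B13Resummation.locE_congr`), `T4HistoryLipschitzRecursion.ScaleZeroFree` and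
  `T4OutputRate.PrefixDependenceOn` of the functional WITH NO HYPOTHESIS, and the pairing-independence of `NE9` ∕ `DecayBound`.

HONEST SCOPE.  (i) The index sets and term values of (2.9)–(2.14) are DATA here (the Gaussian integrals, `χ`, `Γ_k(Z₀, σ(Z))`, `𝐕_k` of
(2.14) are Lemmas 1–3 of record = node N10; the block-model reading of one term is `B13Term214.term214`); only (2.13) and (2.9)∕(2.11)'s
«H(Z) = Σ terms» are definitions.  (ii) The Mayer∕Kotecký–Preiss identity behind (2.12)–(2.13) is not proved here (tree: `B13Resummation`,
[KoteckyPreiss1986]).  (iii) No estimate is asserted: (2.38), (2.41), (1.18), analyticity, the derivative bound and the young-coupling Lipschitz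
shape are `Prop`-valued definitions.  (iv) Background types of `T4OutputRate.Carriers` live in `Type`: the gauge group of the functional of
record is `G : Type`.  (v) Count-neutral; nothing continuum ∕ OS ∕ mass-gap ∕ Clay.  DIVERGENCE D-defB-2 of `Node00.BackgroundActionOfRecord`
(localized terms not objects) is closed one step: the step-(k+1) localized terms are objects defined from the step data.
-/

noncomputable section

open scoped BigOperators

namespace Literature.MathematicalPhysics.QuantumFieldTheory.Balaban1983to89.Node00

open Literature.MathematicalPhysics.QuantumFieldTheory.Balaban1983to89
open Step B14DomainGeom B14.Eq213MaximalDomains B15Eq112TorusCover TreeLengthTorus T4Continuum B14.Eq218Concrete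
open Literature.MathematicalPhysics.QuantumFieldTheory.Balaban1983to89.TreeLengthTorusGeometry (tgeometry TTouch)
open Sect2

namespace W1

/-! ## §1  The carriers of record in the shape `T4OutputRate.Carriers` -/

/-- **THE TWO-RUN PAIRING DATA** (UNPRINTED conventions of `T4OutputRate.Carriers`, recorded as an INPUT): the background carriers of the
two runs (understood as already restricted to the domains of definition), the closeness gauge on run-A backgrounds, the one-step background
transport run B → run A.  Supplied by the NE5∕N18 side of the record; NOTHING of it is read by `T4OutputRate.NE9`, `FadingMemory`,
`DecayBound`, `PrefixDependenceOn` (`ne9_iff_of_pairing`). [cite: Balaban1987RG1, (0.24)-(0.25) p.257 and §1 p.263 (carriers, as in T4OutputRate)] -/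
structure RunPairing where
  /-- run-A backgrounds -/
  BgA : Type
  /-- run-B backgrounds -/
  BgB : Type
  /-- closeness gauge on run-A backgrounds -/
  gauge : BgA → BgA → ℝ
  gauge_nonneg : ∀ U U', 0 ≤ gauge U U'
  /-- background transport run B → run A -/
  transport : BgB → BgA

/-- The ONE-RUN pairing on a background type `B` (gauge `0`, transport `id`): for statements reading only the domain index, the creation
step and `d_j` (NE9-type statements), where no second run is compared. [cite: Balaban1987RG1, §1 p.263 (one run)] -/
def RunPairing.single (B : Type) : RunPairing where
  BgA := B
  BgB := B
  gauge := fun _ _ => 0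
  gauge_nonneg := fun _ _ => le_rfl
  transport := id

/-- **THE INDEX TYPE OF LOCALIZATION DOMAINS OF ALL CREATION STEPS**: pairs `(j, X)`, `X ∈ 𝐃_j` of record (`Sect2.domSys P M j`, the torus
catalogue of non-empty wall-connected families of `M`-cubes of `T^{(j)}`). [cite: Balaban1987RG1, (0.24) p.257 (X ∈ 𝐃_j, all j)] -/
abbrev Dom (P : Params) (M : ℕ) : Type := Σ j, (domSys P M j).Dom

/-- **THE CARRIERS OF RECORD** for the history functional: domains of all creation steps with their step `j` and linear size `d_j(X)`
(`= torusTreeLen`, `histCarriers_d`), and the given pairing data. [cite: Balaban1987RG1, (0.24)-(0.25) p.257] -/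
def histCarriers (P : Params) (M : ℕ) (p : RunPairing) : T4OutputRate.Carriers where
  Dom := W1.Dom P M
  scale := fun X => X.1
  d := fun X => (domSys P M X.1).dj X.2
  d_nonneg := fun X => (domSys P M X.1).dj_nonneg X.2
  BgA := p.BgA
  BgB := p.BgB
  gauge := p.gauge
  gauge_nonneg := p.gauge_nonneg
  transport := p.transport

/-- The creation step of `(j, X)` is `j`. [cite: Balaban1987RG1, (0.24) p.257 (bookkeeping)] -/
@[simp] theorem histCarriers_scale {P : Params} {M : ℕ} (p : RunPairing) (X : W1.Dom P M) : (histCarriers P M p).scale X = X.1 :=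
  rfl

/-- The linear size of `(j, X)` is the torus tree length `d_j(X)` of record. [cite: Balaban1987RG1, p.257 (d_j(X))] -/
@[simp] theorem histCarriers_d {P : Params} {M : ℕ} (p : RunPairing) (X : W1.Dom P M) :
    (histCarriers P M p).d X = torusTreeLen (Subtype.val X.2 : Finset (TPt P.d (domCount P M X.1))) :=
  rfl

/-! ## §2  The one-step cluster data of [II] §2 at step `k` and the DEFINITION (2.13) of `E^{(k+1)}(X)` -/

/-- **THE ONE-STEP CLUSTER DATA AT STEP `k`** (producing the terms of creation step `k+1`), hypothesis-schema: the multi-indices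
`(Z₀, 𝐃 ⊂ 𝐃_k, P, …)` of the sums (2.9), (2.1), (2.3) p.14 as an abstract type `Idx`; for each `Z ∈ 𝐃_{k+1}` the finite set `idx Z` of
indices whose localization (2.10) is `Z`; and the GENERIC TERM (2.14) p.15 `T i (g₀,…,g_k) (𝐔,𝐉) ∈ ℂ` as a function of the young couplings
(a prefix `Fin (k+1) → ℝ`: the step-`k` objects read `g₀, …, g_k` only, [I] p.256) and of the complex configuration `(𝐔,𝐉) ∈ Φ` of record.
The Gaussian integrals, characteristic functions, `Γ_k(Z₀, σ(Z))` and the potentials `𝐕_k` inside (2.14) are NOT typed here (Lemmas 1–3 of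
record). [cite: Balaban1988RG2Cluster, (2.9)-(2.11) p.14 and (2.14) p.15] -/
structure ClusterStep (P : Params) (𝔸 : Type*) (M k : ℕ) where
  /-- the multi-indices `(Z₀, 𝐃, P, …)` of (2.9), (2.1), (2.3) -/
  Idx : Type
  /-- the indices localizing at `Z ∈ 𝐃_{k+1}` ((2.10)) -/
  idx : (domSys P M (k + 1)).Dom → Finset Idx
  /-- the generic term (2.14) at young couplings `(g₀,…,g_k)` and configuration `(𝐔,𝐉)` -/
  T : Idx → (Fin (k + 1) → ℝ) → CPair P 𝔸 → ℂ

/-- The young couplings `(g₀, …, g_k)` of a full history `g`. [cite: Balaban1987RG1, §0 p.256 (g₀,…,g_{k−1})] -/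
def restrictPrefix (k : ℕ) (g : ℕ → ℝ) : Fin (k + 1) → ℝ := fun i => g i

/-- `restrictPrefix` evaluates the history. [cite: Balaban1987RG1, §0 p.256 (bookkeeping)] -/
@[simp] theorem restrictPrefix_apply (k : ℕ) (g : ℕ → ℝ) (i : Fin (k + 1)) : restrictPrefix k g i = g i := rfl

/-- Two histories with the same young couplings have the same prefix. [cite: Balaban1987RG1, §0 p.256 (bookkeeping)] -/
theorem restrictPrefix_congr {k : ℕ} {g g' : ℕ → ℝ} (h : ∀ i < k + 1, g i = g' i) : restrictPrefix k g = restrictPrefix k g' :=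
  funext fun i => h i i.2

/-- **THE COUPLING BOX OF THE YOUNG COUPLINGS** `]0, γ]^{k+1}` (`T4OutputRate.Window γ` restricted to the prefix; [I] Thm 1 p.259 «contained in
an interval ]0, γ]»). [cite: Balaban1987RG1, Thm 1 p.259] -/
def box (γ : ℝ) (k : ℕ) : Set (Fin (k + 1) → ℝ) := {g | ∀ i, 0 < g i ∧ g i ≤ γ}

/-- A history of the window has its young couplings in the box. [cite: Balaban1987RG1, Thm 1 p.259 (bookkeeping)] -/
theorem restrictPrefix_mem_box {γ : ℝ} {g : ℕ → ℝ} (hg : g ∈ T4OutputRate.Window γ) (k : ℕ) : restrictPrefix k g ∈ box γ k :=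
  fun i => hg i

namespace ClusterStep

variable {P : Params} {𝔸 : Type*} {M k : ℕ}

/-- **THE ACTIVITY `H(Z)`** of the polymer expansion (2.11): the sum of the terms localizing at `Z` ((2.9) «H(Z) = Σ_{Z₀} H(Z, Z₀)» with
(2.1), (2.3) summed over `𝐃, P`). [cite: Balaban1988RG2Cluster, (2.9)-(2.11) p.14] -/
def H (S : ClusterStep P 𝔸 M k) (g : Fin (k + 1) → ℝ) (φ : CPair P 𝔸) (Z : (domSys P M (k + 1)).Dom) : ℂ :=
  ∑ i ∈ S.idx Z, S.T i g φ

open Classical in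
/-- **(2.13) p.14 AS THE DEFINITION OF `E^{(k+1)}(X; g₀,…,g_k; (𝐔,𝐉))`, `X ∈ 𝐃_{k+1}`**: «E^{(k+1)}(X) = Σ_{n=1}^∞ (1∕n!) Σ_{(Z₁,…,Z_n):
∪Z_i = X} ρ^T(Z₁,…,Z_n)H(Z₁)⋯H(Z_n)» — in the tree's Kotecký–Preiss form `B13Resummation.locE` (sum of truncated functionals over the
families of polymers whose footprints cover exactly `X`) on the torus polymer geometry `TreeLengthTorusGeometry.tgeometry` of `𝐃_{k+1}` of
record (incompatibility «ζ(Z, Z′) = 0 if Z ∩ Z′ contains a cube, or a wall of a cube» = `TTouch`, footprint = the cubes of `Z`).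
[cite: Balaban1988RG2Cluster, (2.13) p.14] -/
def E (S : ClusterStep P 𝔸 M k) (g : Fin (k + 1) → ℝ) (φ : CPair P 𝔸) (X : (domSys P M (k + 1)).Dom) : ℂ :=
  B13Resummation.locE (tgeometry P.d (domCount P M (k + 1))).ι (tgeometry P.d (domCount P M (k + 1))).cubes (fun Z => S.H g φ Z)
    (Subtype.val X)

/-- The activity at a full history `g` (reads `g₀, …, g_k`): the shape `(ℕ → ℝ) → Φ → 𝐃_{k+1} → ℂ`. [cite: Balaban1988RG2Cluster, (2.11) p.14] -/
def Hh (S : ClusterStep P 𝔸 M k) (g : ℕ → ℝ) (φ : CPair P 𝔸) (Z : (domSys P M (k + 1)).Dom) : ℂ :=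
  S.H (restrictPrefix k g) φ Z

/-- `E^{(k+1)}(X)` at a full history `g` (reads `g₀, …, g_k`). [cite: Balaban1988RG2Cluster, (2.13) p.14] -/
def Eh (S : ClusterStep P 𝔸 M k) (g : ℕ → ℝ) (φ : CPair P 𝔸) (X : (domSys P M (k + 1)).Dom) : ℂ :=
  S.E (restrictPrefix k g) φ X

open Classical in
/-- (2.13) of record IS the localized cluster sum of Road 1's Lipschitz engine: `E^{(k+1)}(X) = Σ_{K: ∪K = X} Φ^T(K; H)` =
`T4ActivityLipschitz.clusterSum TTouch (H ·) (coveringFamilies univ (·.1) X)` (definitionally). [cite: Balaban1988RG2Cluster, (2.13) p.14] -/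
theorem E_eq_clusterSum (S : ClusterStep P 𝔸 M k) (g : Fin (k + 1) → ℝ) (φ : CPair P 𝔸) (X : (domSys P M (k + 1)).Dom) :
    S.E g φ X = T4ActivityLipschitz.clusterSum (TTouch (d := P.d) (N := domCount P M (k + 1))) (fun Z => S.H g φ Z)
      (B13FamilySum.coveringFamilies Finset.univ (fun Z : (domSys P M (k + 1)).Dom => Subtype.val Z) (Subtype.val X)) :=
  rfl

open Classical in
/-- (2.13) of record in the letters of the torus catalogue: incompatibility `TTouch`, footprint `(·.1)` — the representation line
`Ek1 X φ = locE TTouch (·.1) (H · φ) X.1` of `B13Resummation.Repr213` at `tgeometry`, here by `rfl`. [cite: Balaban1988RG2Cluster, (2.13) p.14] -/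
theorem E_eq_locE (S : ClusterStep P 𝔸 M k) (g : Fin (k + 1) → ℝ) (φ : CPair P 𝔸) (X : (domSys P M (k + 1)).Dom) :
    S.E g φ X = B13Resummation.locE (TTouch (d := P.d) (N := domCount P M (k + 1)))
      (fun Z : (domSys P M (k + 1)).Dom => Subtype.val Z) (fun Z => S.H g φ Z) (Subtype.val X) :=
  rfl

/-! ### §2b  Named properties of the one-step data (Prop, asserted nowhere) -/

/-- **LEMMA 3 (2.38) p.20 as a named bound**: «|H(Z)| ≤ C₃ε₁ exp(−(1 − 8δ)½Lκ d_{k+1}(Z))» on the space table `sp` (of record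
`W1.spaceOfRecord … (k+1)`), uniformly in the young couplings of the box `Wk` — amplitude `A` (print `C₃ε₁`) and rate `r` (print
`(1 − 8δ)½Lκ`) as letters. [cite: Balaban1988RG2Cluster, Lemma 3 (2.38) p.20] -/
def Bound238 (S : ClusterStep P 𝔸 M k) (Wk : Set (Fin (k + 1) → ℝ)) (sp : (domSys P M (k + 1)).Dom → Set (CPair P 𝔸)) (A r : ℝ) : Prop :=
  ∀ g ∈ Wk, ∀ Z, ∀ φ ∈ sp Z, ‖S.H g φ Z‖ ≤ A * Real.exp (-(r * (domSys P M (k + 1)).dj Z))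

/-- **THE (2.26) p.17 MAJORANT TABLE, termwise**: every term localizing at `Z` is bounded on the space by its majorant `m i` (the numbers
(2.26) that Lemma 3's resummation (2.28)–(2.37) sums; on the torus `B13Lemma3Torus.bound238_torus` consumes such a table).
[cite: Balaban1988RG2Cluster, (2.26) p.17] -/
def Majorant226 (S : ClusterStep P 𝔸 M k) (Wk : Set (Fin (k + 1) → ℝ)) (sp : (domSys P M (k + 1)).Dom → Set (CPair P 𝔸))
    (m : S.Idx → ℝ) : Prop :=
  ∀ g ∈ Wk, ∀ Z, ∀ i ∈ S.idx Z, ∀ φ ∈ sp Z, ‖S.T i g φ‖ ≤ m i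

/-- **LOCALIZATION OF THE ACTIVITIES** (p.14 «H(Z) is localized in the interior of Z with respect to the external gauge fields»; p.15 «Z̃₀ ⊂ Z ⊂
X for the activities in (2.13)»): `H(Z; g; ·)` depends on `(𝐔,𝐉)` through the bonds of `Z` only (`Sect2.agreeOnSet (domSites … Z)`).
[cite: Balaban1988RG2Cluster, (2.9) p.14 and p.15] -/
def LocalizedH (S : ClusterStep P 𝔸 M k) : Prop :=
  ∀ g Z (φ ψ : CPair P 𝔸), agreeOnSet (domSites P M (k + 1) Z) φ ψ → S.H g φ Z = S.H g ψ Z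

/-- **GAUGE INVARIANCE OF THE ACTIVITIES** (pp.21–22 «the expressions (2.14) are gauge invariant with respect to all G-valued transformations …
extended, by the analyticity, to Gᶜ-valued gauge transformations»): invariance of `H(Z; g; ·)` under the action (I.1.10) `Sect2.cAct` of a
set `𝒰` of gauge transformations. [cite: Balaban1988RG2Cluster, p.21-22 (gauge invariance of (2.14))] -/
def GaugeInvH [Ring 𝔸] (S : ClusterStep P 𝔸 M k) (𝒰 : Set (Site P 0 → 𝔸ˣ)) : Prop :=
  ∀ u ∈ 𝒰, ∀ g (φ : CPair P 𝔸) Z, S.H g (cAct u φ) Z = S.H g φ Z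

/-- **THE DIFFERENCED (2.38) IN THE YOUNG COUPLINGS** (NOT PRINTED — print: [I] p.263 «C^∞-function of g_{j−1} ∈ [0, γ], (or analytic)», last
coupling, qualitative): on the space, `|H(Z; g) − H(Z; g′)| ≤ e^{−r d_{k+1}(Z)} Σ_{i ≤ k} ℓ_i |g_i − g′_i|` for two prefixes of the box — the
activity-level slot whose closing (by the N22 estimate rows) feeds `T4HistoryLipschitzRecursion.StepLipschitz` ∕ `T4OutputRate.NE9`.
[cite: Balaban1987RG1, §1 p.263 (C^∞ in g_{j−1}); Balaban1988RG2Cluster, (2.38) p.20] -/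
def YoungLipschitz (S : ClusterStep P 𝔸 M k) (Wk : Set (Fin (k + 1) → ℝ)) (sp : (domSys P M (k + 1)).Dom → Set (CPair P 𝔸))
    (ℓ : Fin (k + 1) → ℝ) (r : ℝ) : Prop :=
  ∀ g ∈ Wk, ∀ g' ∈ Wk, ∀ Z, ∀ φ ∈ sp Z,
    ‖S.H g φ Z - S.H g' φ Z‖ ≤ Real.exp (-(r * (domSys P M (k + 1)).dj Z)) * ∑ i, ℓ i * |g i - g' i|

section Analytic

variable [NormedRing 𝔸] [NormedAlgebra ℂ 𝔸]

/-- **(2.13an) p.15, the activities**: «the activities in (2.13) … are analytic functions of (𝐔,𝐉), on the space U^c_{k+1}(X, α₀, α₁)» — for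
every young-coupling prefix of the box `Wk` and every `Z`, `H(Z; g; ·)` is holomorphic on `sp Z`. [cite: Balaban1988RG2Cluster, p.15 (analyticity statement)] -/
def AnalyticH (S : ClusterStep P 𝔸 M k) (Wk : Set (Fin (k + 1) → ℝ)) (sp : (domSys P M (k + 1)).Dom → Set (CPair P 𝔸)) : Prop :=
  ∀ g ∈ Wk, ∀ Z, AnalyticOnNhd ℂ (fun φ => S.H g φ Z) (sp Z)

/-- **(2.14) p.15, termwise**: «We consider it as an analytic function of (𝐔,𝐉) in the space U^c_{k+1}(X, α₀, α₁)» — every term localizing at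
`Z` is holomorphic on `sp Z`. [cite: Balaban1988RG2Cluster, (2.14) p.15] -/
def AnalyticT (S : ClusterStep P 𝔸 M k) (Wk : Set (Fin (k + 1) → ℝ)) (sp : (domSys P M (k + 1)).Dom → Set (CPair P 𝔸)) : Prop :=
  ∀ g ∈ Wk, ∀ Z, ∀ i ∈ S.idx Z, AnalyticOnNhd ℂ (fun φ => S.T i g φ) (sp Z)

end Analytic

/-! ### §2c  Proved glue: what (2.13) inherits from the activities -/

/-- A sub-domain's sites are among the domain's sites (`Z ⊂ X ⇒ domSites Z ⊆ domSites X`). [cite: Balaban1987RG1, p.257 (bookkeeping)] -/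
theorem domSites_mono {j : ℕ} {Z X : (domSys P M j).Dom}
    (h : (Subtype.val Z : Finset (TPt P.d (domCount P M j))) ⊆ Subtype.val X) : domSites P M j Z ⊆ domSites P M j X := by
  intro s hs
  simp only [domSites, Set.mem_iUnion] at hs ⊢
  obtain ⟨x, hx, hsx⟩ := hs
  exact ⟨x, h hx, hsx⟩

open Classical in
/-- **`E^{(k+1)}(X)` depends only on the activities of the polymers `Z ⊂ X`** (p.15 «Z̃₀ ⊂ Z ⊂ X for the activities in (2.13)»;
`B13Resummation.locE_congr`). [cite: Balaban1988RG2Cluster, (2.13) p.14 and p.15] -/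
theorem E_congr (S : ClusterStep P 𝔸 M k) {g g' : Fin (k + 1) → ℝ} {φ ψ : CPair P 𝔸} {X : (domSys P M (k + 1)).Dom}
    (h : ∀ Z : (domSys P M (k + 1)).Dom, (Subtype.val Z : Finset (TPt P.d (domCount P M (k + 1)))) ⊆ Subtype.val X →
      S.H g φ Z = S.H g' ψ Z) :
    S.E g φ X = S.E g' ψ X :=
  B13Resummation.locE_congr _ h

/-- **LOCALIZATION OF `E^{(k+1)}(X)`** ([I] p.263 «It depends on the configurations restricted to X»): localized activities give a term
depending on `(𝐔,𝐉)` through the bonds of `X` only. [cite: Balaban1987RG1, §1 p.263; Balaban1988RG2Cluster, p.15] -/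
theorem E_localized (S : ClusterStep P 𝔸 M k) (hloc : S.LocalizedH) (g : Fin (k + 1) → ℝ) {φ ψ : CPair P 𝔸}
    (X : (domSys P M (k + 1)).Dom) (hX : agreeOnSet (domSites P M (k + 1) X) φ ψ) : S.E g φ X = S.E g ψ X :=
  S.E_congr fun Z hZ => hloc g Z φ ψ (agreeOnSet_mono (domSites_mono hZ) hX)

/-- **GAUGE INVARIANCE OF `E^{(k+1)}(X)`** ([I] (1.19) p.263) from that of the activities. [cite: Balaban1987RG1, (1.19) p.263; Balaban1988RG2Cluster, p.21-22] -/
theorem E_gaugeInv [Ring 𝔸] (S : ClusterStep P 𝔸 M k) {𝒰 : Set (Site P 0 → 𝔸ˣ)} (hinv : S.GaugeInvH 𝒰) {u : Site P 0 → 𝔸ˣ}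
    (hu : u ∈ 𝒰) (g : Fin (k + 1) → ℝ) (φ : CPair P 𝔸) (X : (domSys P M (k + 1)).Dom) : S.E g (cAct u φ) X = S.E g φ X :=
  S.E_congr fun Z _ => hinv u hu g φ Z

end ClusterStep

/-! ## §3  The tower of steps and the history functional of record -/

/-- **THE TOWER OF ONE-STEP CLUSTER DATA**: one `ClusterStep` per step `k = 0, 1, 2, …`. [cite: Balaban1988RG2Cluster, §2 p.14 (every step)] -/
abbrev ClusterTower (P : Params) (𝔸 : Type*) (M : ℕ) := ∀ k, ClusterStep P 𝔸 M k

variable {P : Params} {𝔸 : Type*} {M : ℕ}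

/-- **THE TERM OF CREATION STEP `j` ON `X ∈ 𝐃_j` AT THE HISTORY `g` AND CONFIGURATION `(𝐔,𝐉)`**: `E^{(j)}(X; g₀,…,g_{j−1}; (𝐔,𝐉))` =
(2.13) of the step-`(j−1)` data for `j ≥ 1`; `0` for `j = 0` (no term is created before the first step, [I] (0.23) p.256).
[cite: Balaban1988RG2Cluster, (2.13) p.14; Balaban1987RG1, (0.23) p.256] -/
def termC (S : ClusterTower P 𝔸 M) : (j : ℕ) → (domSys P M j).Dom → (ℕ → ℝ) → CPair P 𝔸 → ℂ
  | 0, _, _, _ => 0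
  | k + 1, X, g, φ => (S k).Eh g φ X

/-- At creation step `0` there is no term. [cite: Balaban1987RG1, (0.23) p.256] -/
@[simp] theorem termC_zero (S : ClusterTower P 𝔸 M) (X : (domSys P M 0).Dom) (g : ℕ → ℝ) (φ : CPair P 𝔸) : termC S 0 X g φ = 0 :=
  rfl

/-- At creation step `k+1` the term is (2.13) of the step-`k` data at the young couplings `(g₀,…,g_k)`. [cite: Balaban1988RG2Cluster, (2.13) p.14] -/
theorem termC_succ (S : ClusterTower P 𝔸 M) (k : ℕ) (X : (domSys P M (k + 1)).Dom) (g : ℕ → ℝ) (φ : CPair P 𝔸) :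
    termC S (k + 1) X g φ = (S k).E (restrictPrefix k g) φ X :=
  rfl

/-- The term of creation step `j` reads the young couplings `g₀, …, g_{j−1}` only ([I] p.256 «The function E_k depends also on the effective
coupling constants g₀, …, g_{k−1}») — BY TYPING. [cite: Balaban1987RG1, §0 p.256] -/
theorem termC_congr_prefix (S : ClusterTower P 𝔸 M) (j : ℕ) (X : (domSys P M j).Dom) {g g' : ℕ → ℝ} (h : ∀ i < j, g i = g' i)
    (φ : CPair P 𝔸) : termC S j X g φ = termC S j X g' φ := by
  cases j with
  | zero => rfl
  | succ k => rw [termC_succ, termC_succ, restrictPrefix_congr h]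

/-- **THE HISTORY FUNCTIONAL ON `Φ`** (complex side): `(g, (𝐔,𝐉), ⟨j, X⟩) ↦ E^{(j)}(X; g₀,…,g_{j−1}; (𝐔,𝐉))`. [cite: Balaban1988RG2Cluster, (2.13) p.14; Balaban1987RG1, §1 p.263] -/
def functionalC (S : ClusterTower P 𝔸 M) (g : ℕ → ℝ) (φ : CPair P 𝔸) (X : W1.Dom P M) : ℂ :=
  termC S X.1 X.2 g φ

/-- **THE HISTORY FUNCTIONAL READ ON A BACKGROUND TYPE `B` THROUGH A READING MAP `emb : B → Φ`** (e.g. admissible real fields, restricted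
configurations): `T4OutputRate.Functional (histCarriers P M p) B`, the real part of the complex value. [cite: Balaban1987RG1, (0.24) p.257 and §1 p.263] -/
def functionalOn (S : ClusterTower P 𝔸 M) (p : RunPairing) {B : Type} (emb : B → CPair P 𝔸) :
    T4OutputRate.Functional (histCarriers P M p) B :=
  fun g U X => (functionalC S g (emb U) X).re

/-- **THE HISTORY FUNCTIONAL OF RECORD** `EA : T4OutputRate.Functional (histCarriers P M p) (GaugeField P 0 G)`: the real `G`-valued gauge
field `U` on the fine torus read in `Φ` through `ι : G →* 𝔸ˣ` with `𝐉 = 0` (`Sect2.ofBackgroundC`), value `Re E^{(j)}(X; g₀,…,g_{j−1}; (ιU, 0))`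
— the functional on which `T4OutputRate.NE9` ∕ `DecayBound` ∕ `T4HistoryLipschitzRecursion.StepLipschitz` ∕
`T4CouplingAnalyticity.CouplingAnalytic` are stated by name (`G : Type`: the background types of `T4OutputRate.Carriers` live in `Type`).
[cite: Balaban1987RG1, (0.24) p.257, (1.18) p.263; Balaban1988RG2Cluster, (2.13) p.14] -/
def functional [Ring 𝔸] (S : ClusterTower P 𝔸 M) {G : Type} [Group G] (ι : G →* 𝔸ˣ) (p : RunPairing) :
    T4OutputRate.Functional (histCarriers P M p) (GaugeField P 0 G) :=
  functionalOn S p (ofBackgroundC ι)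

/-- The functional of record at `(g, U, ⟨j, X⟩)`, unfolded. [cite: Balaban1987RG1, (0.24) p.257 (bookkeeping)] -/
theorem functional_apply [Ring 𝔸] (S : ClusterTower P 𝔸 M) {G : Type} [Group G] (ι : G →* 𝔸ˣ) (p : RunPairing) (g : ℕ → ℝ)
    (U : GaugeField P 0 G) (X : W1.Dom P M) : functional S ι p g U X = (termC S X.1 X.2 g (ofBackgroundC ι U)).re :=
  rfl

section Spaces

variable [NormedRing 𝔸] [NormedAlgebra ℂ 𝔸] [CompleteSpace 𝔸]

/-- **THE SPACE TABLE OF RECORD** `(j, X) ↦ U^c_j(X, α₀(j), α₁(j))` (`Sect2.spaceI` on the site set of `X`), for level-dependent constants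
`α₀, α₁` ((1.22) [I] ∕ (2.28) [III]: functions of `g_j` along the flow of record; [I] p.263 uses absolute ones; the (1.17)-margin table is the
same with smaller constants `α′`). [cite: Balaban1987RG1, (1.11)-(1.16) p.262 and p.263; Balaban1988Convergent, (2.28) p.259] -/
def spaceOfRecord {G : Type*} [Group G] (Sg : Setting 𝔸 G) (Rz : Residual P 𝔸) (α₀ α₁ : ℕ → ℝ) (j : ℕ) (X : (domSys P M j).Dom) :
    Set (CPair P 𝔸) :=
  spaceI Sg Rz M j (domSites P M j X) (α₀ j) (α₁ j)

end Spaces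

/-! ## §4  Named properties of the tower (Prop, asserted nowhere): [I] (1.17)–(1.18) and the derivative bound -/

/-- **[I] (1.18) p.263 ∕ [II] (2.41) p.21 SHAPE (complex side)**: «|E^{(j)}(X, g_{j−1}, 𝐔, 𝐉)| ≤ E₀ exp(−κ d_j(X)) … for all configurations
(𝐔,𝐉) ∈ U^c_j(X, α₀, α₁)» with letters `E₀, r`, on a space table `sp`; the real-side reading on the functional of record is
`T4OutputRate.DecayBound` by name. [cite: Balaban1987RG1, (1.18) p.263; Balaban1988RG2Cluster, (2.41) p.21] -/
def TermBound118 (S : ClusterTower P 𝔸 M) (W : Set (ℕ → ℝ)) (sp : (j : ℕ) → (domSys P M j).Dom → Set (CPair P 𝔸)) (E₀ r : ℝ) : Prop :=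
  ∀ g ∈ W, ∀ j (X : (domSys P M j).Dom), ∀ φ ∈ sp j X, ‖termC S j X g φ‖ ≤ E₀ * Real.exp (-(r * (domSys P M j).dj X))

/-- **THE RESTRICTION PROPERTY OF A SPACE TABLE AT ONE LEVEL** (p.15 «The quadratic forms and covariances in H(Z) are analytic functions on
the space of configurations … on the domain Z … therefore we can restrict them, as analytic functions, to the above subspace»): a
configuration of the space on `X` lies in the space on every `Z ⊂ X` — `B13Resummation.SpRestr` at the record. [cite: Balaban1988RG2Cluster, p.15] -/
def SpRestr {j : ℕ} (sp : (domSys P M j).Dom → Set (CPair P 𝔸)) : Prop :=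
  ∀ X Z : (domSys P M j).Dom, (Subtype.val Z : Finset (TPt P.d (domCount P M j))) ⊆ Subtype.val X → sp X ⊆ sp Z

section TowerAnalytic

variable [NormedRing 𝔸] [NormedAlgebra ℂ 𝔸]

/-- **[I] p.263, ANALYTICITY OF THE TERMS**: «E^{(j)}(X, g_{j−1}, 𝐔, 𝐉) is defined and analytic on the space U^c_j(X, α₀, α₁)» — for every
history of `W`, every `j, X`, holomorphy of `E^{(j)}(X; g; ·)` on `sp j X`. [cite: Balaban1987RG1, §1 p.263 (analytic on U^c_j)] -/
def TermAnalytic (S : ClusterTower P 𝔸 M) (W : Set (ℕ → ℝ)) (sp : (j : ℕ) → (domSys P M j).Dom → Set (CPair P 𝔸)) : Prop :=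
  ∀ g ∈ W, ∀ j (X : (domSys P M j).Dom), AnalyticOnNhd ℂ (termC S j X g) (sp j X)

/-- **A CONFIGURATION-DERIVATIVE BOUND ON A SET** (the OBJECT of the ‖E′‖ bound): `f` is complex-differentiable at every point of `s` with
Fréchet derivative of operator norm `≤ B` there.  [I] p.263: configurations obeying (i)–(iii) with smaller constants `α′₀, α′₁` lie inside
`U^c_j(X, α₀, α₁)` — the margin on which Cauchy's estimate turns (1.18) into such a bound (the estimate itself is NOT made here).
[cite: Balaban1987RG1, §1 p.263 (the smaller space inside U^c_j and (1.18))] -/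
def DerivBoundOn (f : CPair P 𝔸 → ℂ) (s : Set (CPair P 𝔸)) (B : ℝ) : Prop :=
  ∀ φ ∈ s, DifferentiableAt ℂ f φ ∧ ‖fderiv ℂ f φ‖ ≤ B

/-- **THE ‖E′‖ BOUND OF THE TOWER ON A SPACE TABLE** (FAN-OUT «(1.17) ‖E′‖ on U^c_k, object-bound»): for every history of `W` and every
`j, X`, `‖∂_{(𝐔,𝐉)} E^{(j)}(X; g; ·)‖ ≤ E₁ e^{−r d_j(X)}` on `sp j X` (of record: the table with the SMALLER constants `α′`).  NOT PRINTED as a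
display; it is what (1.18) + analyticity give by Cauchy on the margin of p.263. [cite: Balaban1987RG1, §1 p.263 and (1.18)] -/
def TermDerivBound (S : ClusterTower P 𝔸 M) (W : Set (ℕ → ℝ)) (sp : (j : ℕ) → (domSys P M j).Dom → Set (CPair P 𝔸)) (E₁ r : ℝ) :
    Prop :=
  ∀ g ∈ W, ∀ j (X : (domSys P M j).Dom), DerivBoundOn (termC S j X g) (sp j X) (E₁ * Real.exp (-(r * (domSys P M j).dj X)))

end TowerAnalytic

/-! ### §4b  The PRINTED coupling-regularity clauses of [I] read on the object, by name (`B12CouplingClausesHistory`) -/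

section PrintedClauses

variable [NormedRing 𝔸] [NormedAlgebra ℂ 𝔸]

/-- **[I] p.263 «It is a C^∞-function of g_{j−1} ∈ [0, γ], (or analytic)» READ ON THE OBJECT**: the history-explicit clause
`B12CouplingClausesHistory.SmoothInLast263` (typer seat `lit-balaban-type-NE-I`) instantiated BY NAME at `E := functionalC S`, `scale := Sigma.fst`,
the space table `sp` of record (`fun j X => spaceOfRecord …`), history set `W`, coordinate set `I` (print `[0, γ]`).  A hypothesis schema;
asserted nowhere. [cite: Balaban1987RG1, §1 p.263 (clause before (1.18))] -/
def SmoothInLastOfRecord (S : ClusterTower P 𝔸 M) (W : Set (ℕ → ℝ)) (I : Set ℝ)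
    (sp : (j : ℕ) → (domSys P M j).Dom → Set (CPair P 𝔸)) : Prop :=
  B12CouplingClausesHistory.SmoothInLast263 W I (fun X : W1.Dom P M => X.1) (fun X => sp X.1 X.2) (functionalC S)

/-- **[I] p.266 «the functions E^{(j)}, β_j are analytic functions of the effective coupling constants» (coordinatewise) READ ON THE OBJECT**:
`B12CouplingClausesHistory.AnalyticInEachCoupling266` at `E := functionalC S`, `scale := Sigma.fst`, the space table of record — the printed
TYPE behind the N22 young-coupling slots (`ClusterStep.YoungLipschitz` adds the unprinted rate and moduli).  A hypothesis schema; asserted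
nowhere. [cite: Balaban1987RG1, §2 p.266 (paragraph after (2.9)) with §1 p.263] -/
def AnalyticInEachOfRecord (S : ClusterTower P 𝔸 M) (W : Set (ℕ → ℝ)) (I : Set ℝ)
    (sp : (j : ℕ) → (domSys P M j).Dom → Set (CPair P 𝔸)) : Prop :=
  B12CouplingClausesHistory.AnalyticInEachCoupling266 W I (fun X : W1.Dom P M => X.1) (fun X => sp X.1 X.2) (functionalC S)

end PrintedClauses

/-! ## §5  Proved glue on the functional of record -/

/-- **NO TERM AT CREATION STEP 0** for the functional read through any `emb`: `T4HistoryLipschitzRecursion.ScaleZeroFree`, for every window.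
[cite: Balaban1987RG1, (0.23) p.256] -/
theorem functionalOn_scaleZeroFree (S : ClusterTower P 𝔸 M) (p : RunPairing) {B : Type} (emb : B → CPair P 𝔸) (W : Set (ℕ → ℝ)) :
    T4HistoryLipschitzRecursion.ScaleZeroFree (functionalOn S p emb) W := by
  rintro g - g' - U ⟨j, X⟩ hj
  change j = 0 at hj
  subst hj
  rfl

/-- **PREFIX DEPENDENCE OF THE FUNCTIONAL — A THEOREM OF THE OBJECT, NO HYPOTHESIS** ([I] p.256; `T4OutputRate.PrefixDependenceOn`): the
scale-`j` value reads `g₀, …, g_{j−1}` only, because the step data are typed on the prefix. [cite: Balaban1987RG1, §0 p.256 and §5 p.298] -/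
theorem functionalOn_prefixDependenceOn (S : ClusterTower P 𝔸 M) (p : RunPairing) {B : Type} (emb : B → CPair P 𝔸)
    (W : Set (ℕ → ℝ)) : T4OutputRate.PrefixDependenceOn (functionalOn S p emb) W := by
  rintro g - g' - U ⟨j, X⟩ h
  show (termC S j X g (emb U)).re = (termC S j X g' (emb U)).re
  rw [termC_congr_prefix S j X h]

/-- `ScaleZeroFree` for the functional of record. [cite: Balaban1987RG1, (0.23) p.256] -/
theorem functional_scaleZeroFree [Ring 𝔸] (S : ClusterTower P 𝔸 M) {G : Type} [Group G] (ι : G →* 𝔸ˣ) (p : RunPairing)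
    (W : Set (ℕ → ℝ)) : T4HistoryLipschitzRecursion.ScaleZeroFree (functional S ι p) W :=
  functionalOn_scaleZeroFree S p _ W

/-- `PrefixDependenceOn` for the functional of record, no hypothesis. [cite: Balaban1987RG1, §0 p.256 and §5 p.298] -/
theorem functional_prefixDependenceOn [Ring 𝔸] (S : ClusterTower P 𝔸 M) {G : Type} [Group G] (ι : G →* 𝔸ˣ) (p : RunPairing)
    (W : Set (ℕ → ℝ)) : T4OutputRate.PrefixDependenceOn (functional S ι p) W :=
  functionalOn_prefixDependenceOn S p _ W

/-- **LOCALIZATION OF THE FUNCTIONAL OF RECORD** ([I] p.257 «depending on U restricted to X»): if every step's activities are localized, two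
real fields agreeing on the bonds of `X` give the same value at `(j, X)`. [cite: Balaban1987RG1, (0.24) p.257 and §1 p.263] -/
theorem functional_localized [Ring 𝔸] (S : ClusterTower P 𝔸 M) (hloc : ∀ k, (S k).LocalizedH) {G : Type} [Group G] (ι : G →* 𝔸ˣ)
    (p : RunPairing) (g : ℕ → ℝ) {U U' : GaugeField P 0 G} (j : ℕ) (X : (domSys P M j).Dom)
    (h : ∀ b : PBond P 0, b.src ∈ domSites P M j X → b.tgt ∈ domSites P M j X → U b = U' b) :
    functional S ι p g U ⟨j, X⟩ = functional S ι p g U' ⟨j, X⟩ := by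
  cases j with
  | zero => rfl
  | succ k =>
    show ((S k).E (restrictPrefix k g) (ofBackgroundC ι U) X).re = ((S k).E (restrictPrefix k g) (ofBackgroundC ι U') X).re
    rw [(S k).E_localized (hloc k) _ X (agreeOnSet_ofBackgroundC ι h)]

/-- **THE PAIRING DATA ARE NOT READ BY NE9**: for a functional on the carriers of record, `T4OutputRate.NE9` is the same statement for any two
pairings (likewise `FadingMemory`, which reads no carrier at all). [cite: Balaban1987RG1, §1 p.263 (NE9 reads Dom, scale, d only)] -/
theorem ne9_iff_of_pairing (p p' : RunPairing) {B : Type} (E : (ℕ → ℝ) → B → W1.Dom P M → ℝ) (W : Set (ℕ → ℝ)) (κ : ℝ)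
    (Λ : ℕ → ℕ → ℝ) :
    T4OutputRate.NE9 (C := histCarriers P M p) E W κ Λ ↔ T4OutputRate.NE9 (C := histCarriers P M p') E W κ Λ :=
  Iff.rfl

/-- `DecayBound` likewise reads no pairing field. [cite: Balaban1987RG1, (1.18) p.263 (bookkeeping)] -/
theorem decayBound_iff_of_pairing (p p' : RunPairing) {B : Type} (E : (ℕ → ℝ) → B → W1.Dom P M → ℝ) (W : Set (ℕ → ℝ)) (E₀ κ : ℝ) :
    T4OutputRate.DecayBound (C := histCarriers P M p) E W E₀ κ ↔ T4OutputRate.DecayBound (C := histCarriers P M p') E W E₀ κ :=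
  Iff.rfl

end W1

end Literature.MathematicalPhysics.QuantumFieldTheory.Balaban1983to89.Node00
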